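import Summits.BirchSwinnertonDyer.BirchSwinnertonDyer.Theorems.ByReductionTypeAtTwoRankOneAtTwoOneDoorLawBottomDefs
import HarnessLib

/-!
# Route ByReductionTypeAtTwo, crux `RankOneAtTwoBigImageOddLocal` (stmt-BirchSwinnertonDyer-23715), LINE v8.14 `one_door_analytic`:
# the SUB-SLICE SPLIT inside the skeleton — `HasBottomRungDoorAtTwo`, `HasLawfulDoorAtTwo`, and the ONE ∀∃ residue
# `DoorIndexLawFullCAtTwoSomeDoorOffSubslice`

Lead prover seat `bsd-line-fkl-p1` g15 (2026-08-28).  Companion of `…OneDoorLawBottomDefs.lean` (APPEND #7/#7b: the bottom rung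
`DoorIndexLawUpperCAtTwoBottom` and its complement `DoorIndexLawUpperCAtTwoOffBottom`), as a separate module so that the statements
files stay under the size limit.  Statements + import-free bookkeeping only; nothing is asserted; BSD is not proved by any of this.

Why.  After v8.13 the line carries its open content as TWO universal conjecture-grade stubs — `DoorIndexLawUpperCAtTwoOffBottom`
(the Euler-system half at EVERY door datum off the bottom rung: non-minimal doors, `m ≥ 1`, even constants) and
`DoorIndexLawLowerCAtTwo` (the converse half at EVERY door datum) — while the PROVED content is the sub-slice theorem
`bsdp_two_of_exists_bottomRungDoor` (`Theorems/…OneDoorBottomSubslice.lean`, lead g14; CT-free sequel by the width seat):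
every `W` of the slice ADMITTING a bottom-rung door datum satisfies `BSDp W 2`, modulo print and the route's rank-`0` cruxes.  Two
kernel facts make both universal stubs far larger than what the crux needs:

1. the per-datum law is an EQUIVALENCE with `BSDp W 2` at every non-vanishing door datum (`bsdp_two_iff_doorLawFullC_at_of_rank`,
   modulo Gross–Zagier / Kolyvagin / modularity and `BSDp Wd 2`), so the AN-28c identity at ONE door datum of `W` gives `BSDp W 2`
   and hence the identity (both halves) at EVERY door datum of the same `W`;
2. a curve WITH a bottom-rung door datum already has `BSDp W 2` (the sub-slice theorem), so at all its OTHER data — non-minimal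
   doors, `2`-divisible Heegner points, even constants — both halves are THEOREMS modulo print and rank-`0` `BSD₂` of the twins.

Hence the honest open content of the line is ONE ∀∃ statement about the COMPLEMENT of the sub-slice: every `W` of the slice with
NO bottom-rung door datum has SOME door datum at which the AN-28c identity holds (`DoorIndexLawFullCAtTwoSomeDoorOffSubslice`
below).  The skeleton v8.14 carries it as the single conjecture-grade stub; the composition is a case split on
`HasBottomRungDoorAtTwo W` (`Theorems/…OneDoorSubsliceSplit.lean`: `rankOneAtTwoBigImageOddLocal_of_someDoorOffSubslice`), and the
reshape is LOSSLESS modulo the five printed facts and the rank-`0` cruxes (same file: v8.13's stubs ⟹ the residue ⟹ the crux ⟹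
`DoorIndexLawFullCAtTwo` at every datum ⟹ v8.13's stubs).

Reading of the residue (for the pen and the disprover).  Under the law, `W` has no bottom-rung door datum iff at every MINIMAL
odd-constant non-vanishing admissible door `Ш(W)[2] ≠ 0 ∨ Ш(Wd)[2] ≠ 0` (U₀ and its `m = 0` converse); so the residue is `BSD₂` in
Heegner-index currency for: the curves of the slice with `Ш(W)[2] ≠ 0` (there EVERY door has `m ≥ 1`: Kolyvagin exactness at `2`
beyond the first layer — route GenusKolyvaginAtTwo's structure theorem 24882 / `Δ_W > 0` residual 24883), and the curves with
`Ш(W)[2] = 0` none of whose minimal odd-constant non-vanishing doors has a `2`-torsion-free `Ш` of the twin (conjecturally only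
the curves with no odd-constant datum at all, i.e. the `2`-primary Manin question at additive level `4 ∣ N`; at `Δ_W < 0` the width
seat gk2-p4's `exists_transpAdmissible_door_twistSelmerTwoCard_eq_one` supplies an admissible prime door with `#Sel₂(Wd) = 1`,
whose non-vanishing `L(Wd, 1) ≠ 0` is the rank-`0` `2`-converse).  The prover of the residue CHOOSES the door.

References (locators): Gross–Zagier 1986 Thm. I.6.3 and V.§2; Gross 1991 Conj. 1.2, §3 and §10; Kolyvagin 1990 Thm. A; Kramer 1981
Thm. 1 and Prop. 3; Mazur–Rubin 2010 Cor. 3.4 (i).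
-/

set_option autoImplicit false

noncomputable section

open scoped Classical

set_option linter.dupNamespace false

namespace Summit.BirchSwinnertonDyer.BirchSwinnertonDyer.Theorems.RankOneAtTwoOneDoor

open Literature.NumberTheory.EllipticCurves Literature.NumberTheory.EllipticCurves.ModularForms
  Summit.BirchSwinnertonDyer.Rank1Residual.F1Sign2
  Summit.BirchSwinnertonDyer.Rank1Residual.F1Sign2.TranspositionDoor

/-! ### APPEND #8 (lead prover seat `bsd-line-fkl-p1` g15, 2026-08-28) — LINE v8.14: the SUB-SLICE SPLIT -/

/-- **`W` admits a BOTTOM-RUNG DOOR DATUM**: an imaginary quadratic `K` with `d_K` door-admissible, `L(W^{(d_K)}, 1) ≠ 0` and the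
door MINIMAL (`t + 2s = [Δ_W < 0]`: one error place), a parametrisation datum `Dt` of level `N_W` with ODD constant, `H`, `ι`, a
point `P ∈ E(K)` mapping to the complex Heegner point that is NOT `2`-divisible modulo torsion (`HasTwoDivisibilityUpToTorsion W K P 0`),
and a globally minimal model `Wd = Cd • W^{(d_K)}` of the twist.  VERBATIM the existential hypothesis `hdoor` of the sub-slice theorem
`bsdp_two_of_exists_bottomRungDoor` (`Theorems/…OneDoorBottomSubslice.lean`): the curves of the crux's slice satisfying it have
`BSDp W 2` modulo print and the route's rank-`0` cruxes. [cite: GrossLMS1991, §10] [cite: Kolyvagin1990, Thm. A] -/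
def HasBottomRungDoorAtTwo (W : WeierstrassCurve ℚ) [W.IsElliptic] [W.IsGloballyMinimal] [NeZero (W.conductorNorm ℤ)] : Prop :=
  ∃ (K : Type) (_ : Field K) (_ : NumberField K), IsImaginaryQuadratic K ∧ DoorAdmissible W (NumberField.discr K) ∧
    (W.quadraticTwist (NumberField.discr K : ℚ)).entireLFunction 1 ≠ 0 ∧
    transpCount W (NumberField.discr K) + 2 * identCount W (NumberField.discr K) = (if W.Δ < 0 then 1 else 0) ∧
    ∃ (Dt : ModularParametrizationData W (W.conductorNorm ℤ)) (H : HeegnerDatum (W.conductorNorm ℤ) (NumberField.discr K))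
      (ι : K →+* ℂ) (P : (W.baseChange K).toAffine.Point) (Wd : WeierstrassCurve ℚ) (_ : Wd.IsElliptic) (_ : Wd.IsGloballyMinimal)
      (Cd : WeierstrassCurve.VariableChange ℚ),
      WeierstrassCurve.Affine.Point.map ι.toRatAlgHom P = heegnerPointComplex Dt H ∧
        Cd • W.quadraticTwist (NumberField.discr K : ℚ) = Wd ∧ Odd Dt.c ∧ HasTwoDivisibilityUpToTorsion W K P 0

/-- **`W` admits a LAWFUL DOOR DATUM**: a non-vanishing admissible door datum `(K, Dt, H, ι, P, Wd, Cd)` (ANY constant, ANY door,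
minimal or not) together with an exact `2`-divisibility exponent `m` of `P` modulo torsion at which the AN-28c identity
`2m + [Δ_W < 0] = ord₂ #Ш(W)[2^∞] + ord₂ #Ш(Wd)[2^∞] + t + 2s + 2·v₂(c)` HOLDS — the conclusion of `DoorIndexLawFullCAtTwo` at ONE
datum, existentially packaged.  By the per-datum kernel iff `bsdp_two_iff_doorLawFullC_at_of_rank` this is `BSDp W 2` read at that
datum (modulo Gross–Zagier, Kolyvagin, modularity and `BSDp Wd 2`). [cite: GrossZagier1986, Thm. I.6.3 and V.§2]
[cite: GrossLMS1991, Conj. 1.2 and §3] -/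
def HasLawfulDoorAtTwo (W : WeierstrassCurve ℚ) [W.IsElliptic] [W.IsGloballyMinimal] [NeZero (W.conductorNorm ℤ)] : Prop :=
  ∃ (K : Type) (_ : Field K) (_ : NumberField K), IsImaginaryQuadratic K ∧ DoorAdmissible W (NumberField.discr K) ∧
    (W.quadraticTwist (NumberField.discr K : ℚ)).entireLFunction 1 ≠ 0 ∧
    ∃ (Dt : ModularParametrizationData W (W.conductorNorm ℤ)) (H : HeegnerDatum (W.conductorNorm ℤ) (NumberField.discr K))
      (ι : K →+* ℂ) (P : (W.baseChange K).toAffine.Point) (Wd : WeierstrassCurve ℚ) (_ : Wd.IsElliptic) (_ : Wd.IsGloballyMinimal)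
      (Cd : WeierstrassCurve.VariableChange ℚ),
      WeierstrassCurve.Affine.Point.map ι.toRatAlgHom P = heegnerPointComplex Dt H ∧
        Cd • W.quadraticTwist (NumberField.discr K : ℚ) = Wd ∧
        ∃ m : ℕ, HasTwoDivisibilityUpToTorsion W K P m ∧
          2 * m + (if W.Δ < 0 then 1 else 0) =
            padicValNat 2 (Nat.card (AddCommGroup.primaryComponent W.sha 2)) +
              padicValNat 2 (Nat.card (AddCommGroup.primaryComponent Wd.sha 2)) +
              transpCount W (NumberField.discr K) + 2 * identCount W (NumberField.discr K) +
              2 * padicValInt 2 Dt.c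

/-- **THE RESIDUE OF THE CRUX OFF ITS PROVED SUB-SLICE — `DoorIndexLawFullCAtTwoSomeDoorOffSubslice` (CONJECTURE; the ONE
load-bearing stub of LINE v8.14).**  `W` globally minimal, non-CM, `ρ_{W,2^n}` onto for all `n`, odd torsion order, odd Tamagawa
product, analytic rank one, and `W` admits NO bottom-rung door datum (`¬ HasBottomRungDoorAtTwo W`: at every minimal odd-constant
non-vanishing admissible door the Heegner point IS `2`-divisible modulo torsion).  THEN `W` admits a LAWFUL door datum: SOME
non-vanishing admissible door datum and exponent at which `2m + [Δ_W < 0] = ord₂ #Ш(W)[2^∞] + ord₂ #Ш(Wd)[2^∞] + t + 2s + 2·v₂(c)`.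
Relation to v8.13: `DoorIndexLawUpperCAtTwoOffBottom ∧ DoorIndexLawLowerCAtTwo ⟹` this (at any datum, which exists by Hoffstein–Luo +
modularity; the exponent by Gross–Zagier + Kolyvagin), and conversely this `⟹` the crux `⟹ DoorIndexLawFullCAtTwo` at EVERY datum
(`Theorems/…OneDoorSubsliceSplit.lean`), all modulo the five printed facts and the route's rank-`0` cruxes: the reshape is lossless
and the statement is `BSD₂` on the complement of the sub-slice in Heegner-index currency, with the door at the prover's CHOICE.
Why it might fail: it is the `2`-part of BSD for the rank-one curves of the slice whose minimal doors all have `2`-divisible Heegner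
points (conjecturally: `Ш(W)[2] ≠ 0`, or every minimal non-vanishing twin has `Ш(Wd)[2] ≠ 0`) — Kolyvagin exactness at `2` beyond the
first layer and its converse.  Census: = AN-28c's (ENGINE L j300076 + j303912, 1020/1020 certified rows; the rows with `s_W > 0` or
`m > 0` are the residue's). [cite: GrossLMS1991, Conj. 1.2, §3 and §10] [cite: Kolyvagin1990, Thm. A] [cite: GrossZagier1986, Thm. I.6.3 and V.§2] -/
@[conjecture] def DoorIndexLawFullCAtTwoSomeDoorOffSubslice : Prop :=
  ∀ (W : WeierstrassCurve ℚ) [W.IsElliptic] [W.IsGloballyMinimal] [NeZero (W.conductorNorm ℤ)],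
    ¬ W.HasCM → (∀ n : ℕ, W.HasSurjectiveModNGaloisRep ((2 ^ n : ℕ) : ℤ)) → Odd W.torsionOrder → Odd W.tamagawaProduct →
    W.analyticRank = 1 → ¬ HasBottomRungDoorAtTwo W → HasLawfulDoorAtTwo W

/-- **The hypothesis-free form — `DoorIndexLawFullCAtTwoSomeDoor` (CONJECTURE): EVERY `W` of the slice admits a lawful door datum.**
On the sub-slice this is a THEOREM modulo print (a bottom-rung datum is lawful with `m = 0`: U₀ gives `Ш(W)[2^∞] = Ш(Wd)[2^∞] = 0`,
`hasLawfulDoorAtTwo_of_bottomRung_of_doorIndexLawUpperCAtTwoBottom`), so it is the residue above plus nothing open; it is recorded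
because it is the cleanest one-line form of the line's content: `BSD₂` of the slice ⟺ every curve of the slice has ONE door datum
where the Heegner index, the two `Ш[2^∞]` and the door's local terms balance. [cite: GrossLMS1991, Conj. 1.2 and §3]
[cite: GrossZagier1986, Thm. I.6.3 and V.§2] -/
@[conjecture] def DoorIndexLawFullCAtTwoSomeDoor : Prop :=
  ∀ (W : WeierstrassCurve ℚ) [W.IsElliptic] [W.IsGloballyMinimal] [NeZero (W.conductorNorm ℤ)],
    ¬ W.HasCM → (∀ n : ℕ, W.HasSurjectiveModNGaloisRep ((2 ^ n : ℕ) : ℤ)) → Odd W.torsionOrder → Odd W.tamagawaProduct →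
    W.analyticRank = 1 → HasLawfulDoorAtTwo W

/-! ### Import-free bookkeeping -/

/-- The hypothesis-free form implies the residue (drop the hypothesis). [cite: GrossLMS1991, Conj. 1.2 and §3] -/
theorem doorIndexLawFullCAtTwoSomeDoorOffSubslice_of_someDoor (h : DoorIndexLawFullCAtTwoSomeDoor) :
    DoorIndexLawFullCAtTwoSomeDoorOffSubslice :=
  fun W _ _ _ hCM hsurj hT hc hr _ => h W hCM hsurj hT hc hr

/-- **The identity at a bottom-rung datum with `2`-torsion-free `Ш`'s holds with exponent `0`** (import-free arithmetic: at a minimal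
door with odd constant, `s_W = s_d = 0` makes the identity `[Δ_W < 0] = 0 + 0 + [Δ_W < 0] + 0`). [cite: GrossLMS1991, Prop. 2.1 and §10] -/
theorem lawful_identity_at_bottom (W : WeierstrassCurve ℚ) [W.IsGloballyMinimal] (d : ℤ) (c : ℤ) (sW sd : ℕ)
    (hmin : transpCount W d + 2 * identCount W d = (if W.Δ < 0 then 1 else 0)) (hc : Odd c) (hsW : sW = 0) (hsd : sd = 0) :
    2 * 0 + (if W.Δ < 0 then 1 else 0) = sW + sd + transpCount W d + 2 * identCount W d + 2 * padicValInt 2 c := by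
  have hc2 : ¬ (2 : ℤ) ∣ c := fun h => Int.not_even_iff_odd.mpr hc (even_iff_two_dvd.mpr h)
  rw [padicValInt.eq_zero_of_not_dvd hc2, hsW, hsd]
  by_cases hΔ : W.Δ < 0
  · rw [if_pos hΔ] at hmin ⊢; omega
  · rw [if_neg hΔ] at hmin ⊢; omega

/-- **U₀ makes every bottom-rung datum lawful**: given the bottom rung `DoorIndexLawUpperCAtTwoBottom` (a theorem modulo five
printed facts, `doorIndexLawUpperCAtTwoBottom_of_print_ctFree`), a curve of the slice with a bottom-rung door datum has a lawful
door datum — the same one, with `m = 0`. [cite: GrossLMS1991, §10] [cite: Kolyvagin1990, Thm. A] -/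
theorem hasLawfulDoorAtTwo_of_bottomRung_of_doorIndexLawUpperCAtTwoBottom (hU0 : DoorIndexLawUpperCAtTwoBottom)
    (W : WeierstrassCurve ℚ) [W.IsElliptic] [W.IsGloballyMinimal] [NeZero (W.conductorNorm ℤ)]
    (hCM : ¬ W.HasCM) (hsurj : ∀ n : ℕ, W.HasSurjectiveModNGaloisRep ((2 ^ n : ℕ) : ℤ)) (hT : Odd W.torsionOrder)
    (hc : Odd W.tamagawaProduct) (hr : W.analyticRank = 1) (hdoor : HasBottomRungDoorAtTwo W) :
    HasLawfulDoorAtTwo W := by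
  unfold HasBottomRungDoorAtTwo at hdoor
  obtain ⟨K, iF, iN, hK, hadm, hLt, hmin, Dt, H, ι, P, Wd, iE, iM, Cd, hP, hWd, hodd, hm0⟩ := hdoor
  have hineq := hU0 W hCM hsurj hT hc hr K hK hadm hLt Dt H ι P hP Wd Cd hWd hmin hodd hm0
  obtain ⟨hsW, hsd⟩ := (bottom_conclusion_iff W (NumberField.discr K) Dt.c _ _ hmin hodd).mp hineq
  unfold HasLawfulDoorAtTwo
  refine ⟨K, iF, iN, hK, hadm, hLt, Dt, H, ι, P, Wd, iE, iM, Cd, hP, hWd, 0, hm0, ?_⟩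
  exact lawful_identity_at_bottom W (NumberField.discr K) Dt.c _ _ hmin hodd hsW hsd

/-- **The residue plus U₀ give the hypothesis-free form** (case split on `HasBottomRungDoorAtTwo W`). [cite: GrossLMS1991, §10 and Conj. 1.2] -/
theorem doorIndexLawFullCAtTwoSomeDoor_of_offSubslice_of_bottom (h : DoorIndexLawFullCAtTwoSomeDoorOffSubslice)
    (hU0 : DoorIndexLawUpperCAtTwoBottom) : DoorIndexLawFullCAtTwoSomeDoor := by
  intro W _ _ _ hCM hsurj hT hc hr
  by_cases hdoor : HasBottomRungDoorAtTwo W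
  · exact hasLawfulDoorAtTwo_of_bottomRung_of_doorIndexLawUpperCAtTwoBottom hU0 W hCM hsurj hT hc hr hdoor
  · exact h W hCM hsurj hT hc hr hdoor

/-- **AN-28c at a datum makes it lawful** (packaging: `DoorIndexLawFullCAtTwo` applied at one given non-vanishing admissible door
datum yields `HasLawfulDoorAtTwo W`; the EXISTENCE of a datum — Hoffstein–Luo door, modularity, `K`-rational Heegner point, minimal
model — is supplied in `Theorems/…OneDoorSubsliceSplit.lean`). [cite: GrossLMS1991, Conj. 1.2 and §3] -/
theorem hasLawfulDoorAtTwo_of_doorIndexLawFullCAtTwo_at (h : DoorIndexLawFullCAtTwo)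
    (W : WeierstrassCurve ℚ) [W.IsElliptic] [W.IsGloballyMinimal] [NeZero (W.conductorNorm ℤ)]
    (hCM : ¬ W.HasCM) (hsurj : ∀ n : ℕ, W.HasSurjectiveModNGaloisRep ((2 ^ n : ℕ) : ℤ)) (hT : Odd W.torsionOrder)
    (hc : Odd W.tamagawaProduct) (hr : W.analyticRank = 1)
    (K : Type) [iF : Field K] [iN : NumberField K] (hK : IsImaginaryQuadratic K) (hadm : DoorAdmissible W (NumberField.discr K))
    (hLt : (W.quadraticTwist (NumberField.discr K : ℚ)).entireLFunction 1 ≠ 0)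
    (Dt : ModularParametrizationData W (W.conductorNorm ℤ)) (H : HeegnerDatum (W.conductorNorm ℤ) (NumberField.discr K))
    (ι : K →+* ℂ) (P : (W.baseChange K).toAffine.Point)
    (hP : WeierstrassCurve.Affine.Point.map ι.toRatAlgHom P = heegnerPointComplex Dt H)
    (Wd : WeierstrassCurve ℚ) [iE : Wd.IsElliptic] [iM : Wd.IsGloballyMinimal] (Cd : WeierstrassCurve.VariableChange ℚ)
    (hWd : Cd • W.quadraticTwist (NumberField.discr K : ℚ) = Wd) :
    HasLawfulDoorAtTwo W := by
  obtain ⟨m, hm, hlaw⟩ := h W hCM hsurj hT hc hr K hK hadm hLt Dt H ι P hP Wd Cd hWd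
  unfold HasLawfulDoorAtTwo
  exact ⟨K, iF, iN, hK, hadm, hLt, Dt, H, ι, P, Wd, iE, iM, Cd, hP, hWd, m, hm, hlaw⟩

/-- **The two halves at a datum make it lawful**, given an exponent of the Heegner point (in rank one it exists:
`exists_unique_exponent_at_door`, modulo Gross–Zagier + Kolyvagin + modularity). [cite: GrossLMS1991, Conj. 1.2 and §3] -/
theorem hasLawfulDoorAtTwo_of_halves_at (hU : DoorIndexLawUpperCAtTwo) (hL : DoorIndexLawLowerCAtTwo)
    (W : WeierstrassCurve ℚ) [W.IsElliptic] [W.IsGloballyMinimal] [NeZero (W.conductorNorm ℤ)]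
    (hCM : ¬ W.HasCM) (hsurj : ∀ n : ℕ, W.HasSurjectiveModNGaloisRep ((2 ^ n : ℕ) : ℤ)) (hT : Odd W.torsionOrder)
    (hc : Odd W.tamagawaProduct) (hr : W.analyticRank = 1)
    (K : Type) [iF : Field K] [iN : NumberField K] (hK : IsImaginaryQuadratic K) (hadm : DoorAdmissible W (NumberField.discr K))
    (hLt : (W.quadraticTwist (NumberField.discr K : ℚ)).entireLFunction 1 ≠ 0)
    (Dt : ModularParametrizationData W (W.conductorNorm ℤ)) (H : HeegnerDatum (W.conductorNorm ℤ) (NumberField.discr K))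
    (ι : K →+* ℂ) (P : (W.baseChange K).toAffine.Point)
    (hP : WeierstrassCurve.Affine.Point.map ι.toRatAlgHom P = heegnerPointComplex Dt H)
    (Wd : WeierstrassCurve ℚ) [iE : Wd.IsElliptic] [iM : Wd.IsGloballyMinimal] (Cd : WeierstrassCurve.VariableChange ℚ)
    (hWd : Cd • W.quadraticTwist (NumberField.discr K : ℚ) = Wd) (m : ℕ) (hm : HasTwoDivisibilityUpToTorsion W K P m) :
    HasLawfulDoorAtTwo W := by
  unfold HasLawfulDoorAtTwo
  exact ⟨K, iF, iN, hK, hadm, hLt, Dt, H, ι, P, Wd, iE, iM, Cd, hP, hWd, m, hm,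
    doorIndexLaw_eq_of_halves hU hL W hCM hsurj hT hc hr K hK hadm hLt Dt H ι P hP Wd Cd hWd m hm⟩

/-- **Off the sub-slice, every exponent at a minimal odd-constant non-vanishing door is positive** (unfolding of
`¬ HasBottomRungDoorAtTwo W`: such a datum with `m = 0` would be a bottom-rung datum). [cite: GrossLMS1991, §10] -/
theorem exponent_pos_of_not_hasBottomRungDoorAtTwo
    (W : WeierstrassCurve ℚ) [W.IsElliptic] [W.IsGloballyMinimal] [NeZero (W.conductorNorm ℤ)]
    (hoff : ¬ HasBottomRungDoorAtTwo W)
    (K : Type) [iF : Field K] [iN : NumberField K] (hK : IsImaginaryQuadratic K) (hadm : DoorAdmissible W (NumberField.discr K))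
    (hLt : (W.quadraticTwist (NumberField.discr K : ℚ)).entireLFunction 1 ≠ 0)
    (hmin : transpCount W (NumberField.discr K) + 2 * identCount W (NumberField.discr K) = (if W.Δ < 0 then 1 else 0))
    (Dt : ModularParametrizationData W (W.conductorNorm ℤ)) (H : HeegnerDatum (W.conductorNorm ℤ) (NumberField.discr K))
    (ι : K →+* ℂ) (P : (W.baseChange K).toAffine.Point)
    (hP : WeierstrassCurve.Affine.Point.map ι.toRatAlgHom P = heegnerPointComplex Dt H) (hodd : Odd Dt.c)
    (Wd : WeierstrassCurve ℚ) [iE : Wd.IsElliptic] [iM : Wd.IsGloballyMinimal] (Cd : WeierstrassCurve.VariableChange ℚ)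
    (hWd : Cd • W.quadraticTwist (NumberField.discr K : ℚ) = Wd) (m : ℕ) (hm : HasTwoDivisibilityUpToTorsion W K P m) :
    0 < m := by
  rcases Nat.eq_zero_or_pos m with h0 | hpos
  · subst h0
    exfalso
    apply hoff
    unfold HasBottomRungDoorAtTwo
    exact ⟨K, iF, iN, hK, hadm, hLt, hmin, Dt, H, ι, P, Wd, iE, iM, Cd, hP, hWd, hodd, hm⟩
  · exact hpos

/-! ### APPEND #9 (lead prover seat `bsd-line-fkl-p1` g15, 2026-08-28T21:xxZ) — the `Δ_W < 0`, `Ш(W)[2] = 0` PART OF THE RESIDUE IS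
KOLYVAGIN NON-DIVISIBILITY AT A `Sel₂`-TRIVIAL PRIME DOOR (W. Zhang's theorem at `p = 2`)

Who is off the sub-slice?  Under the law, the curves with `Ш(W)[2] ≠ 0` and the curves with `Ш(W)[2] = 0` none of whose minimal odd-constant
non-vanishing doors has `Ш(Wd)[2] = 0`.  For the second kind at `Δ_W < 0` the tree HAS the supply: route GenusKolyvaginAtTwo's width seat gk2-p4
(`GenusKolyTransp.exists_transpAdmissible_door_twistSelmerTwoCard_eq_one`, 2026-08-28): every globally minimal `W` with `Δ_W < 0`, `E(ℚ)[2] = 0`,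
`rank E(ℚ) = 1`, `Ш(W)[2] = 0` has an imaginary quadratic `K` and a prime `q₀` with `(d_K, q₀)` TRANSPOSITION-admissible (so the door is minimal:
`t = 1`, `s = 0`), the door OPEN at `q₀` (`MeetsNonNormAt`), `(d_K, N_W) = 1`, the Heegner hypothesis, and `#Sel₂(W^{(d_K)}) = 1` — unconditionally.
At such a door the lawful identity with an odd constant reads `2m + 1 = 0 + 0 + 1 + 0 + 0`, i.e. `m = 0`.  So on the class
{`Δ_W < 0`, `Ш(W)[2] = 0`, an odd-constant datum exists} the residue is EXACTLY the statement below — the Heegner point over that `K` is not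
`2`-divisible modulo torsion — and it needs NO `L`-value input: a non-`2`-divisible point is non-torsion, so `L'(E/K,1) ≠ 0` by Gross–Zagier and
`L(W^{(d_K)},1) ≠ 0` by the factorisation `L'(E/K,1) = L'(E,1)·L(W^{(d_K)},1)`; the door is then a bottom-rung door and `BSDp W 2` follows from the
sub-slice theorem (`Theorems/…OneDoorSubsliceNegDisc.lean`: `bsdp_two_of_heegnerNonDivisibility_negDisc`).  This is W. Zhang's theorem «Kolyvagin's
conjecture: `y_K ∉ p E(K)` when `Sel_p(E/K)` has rank one» (Camb. J. Math. 2 (2014) Thm. 1.1; printed for `p ≥ 5`, `ρ̄_{E,p}` surjective) in its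
simplest instance at `p = 2`: `Sel₂(E/ℚ) ≅ ℤ/2` (rank `1`, `Ш[2] = 0`, `E(ℚ)[2] = 0`), `Sel₂(E^{(d_K)}/ℚ) = 0`.  Nothing is asserted. -/

/-- **R⁻₀ `HeegnerNonDivisibilityAtSelmerTrivialPrimeDoorAtTwo` — KOLYVAGIN'S CONJECTURE AT `2` AT A `Sel₂`-TRIVIAL PRIME DOOR (CONJECTURE; the
`Δ_W < 0`, `Ш(W)[2] = 0` part of LINE v8.14's residue).**  `W/ℚ` globally minimal, non-CM, `ρ_{W,2^n}` onto for all `n`, odd torsion order, odd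
Tamagawa product, analytic rank `1`, `Δ_W < 0`, `Ш(W)[2] = 0` (`ShaTwoTrivial W`); `K` imaginary quadratic and `q₀` a prime with `(d_K, q₀)`
transposition-admissible (`TranspAdmissible`: `d_K < 0` square-free, `≡ 1 (8)`, `q₀ ∣ d_K` the one prime at which the `2`-division cubic acquires
exactly one root, every other prime of `d_K` good with odd trace, `d_K` a square at the odd bad primes), the door open at `q₀` (`MeetsNonNormAt W q₀`),
`(d_K, N_W) = 1`, the Heegner hypothesis, and `#Sel₂(W^{(d_K)}) = 1`; `Dt` a parametrisation datum of level `N_W` with ODD constant, `H`, `ι`, and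
`P ∈ E(K)` mapping to the complex Heegner point.  THEN `P ∉ 2E(K) + E(K)_tors` (`HasTwoDivisibilityUpToTorsion W K P 0`).
Why it might fail: it is Kolyvagin's conjecture at the prime `2` (no eigenspace decomposition of `E[2]` under complex conjugation; Zhang's proof uses
level raising and multiplicity one modulo `p ≥ 5`).  Census: every `Δ < 0`, `m = 0` row of AN-28c's ENGINE L tables with `s_W = s_d = 0` is an
instance (812/812 direct at the `Δ < 0` corner, lead report G11 §6); the supply exists for every curve of the class (gk2-p4, unconditional).
[cite: Zhang2014CJM, Thm. 1.1 (p ≥ 5; shape only; nothing asserted)] [cite: GrossLMS1991, Conj. 1.2, §3 and §10] [cite: Kolyvagin1990, Thm. A] -/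
@[conjecture] def HeegnerNonDivisibilityAtSelmerTrivialPrimeDoorAtTwo : Prop :=
  ∀ (W : WeierstrassCurve ℚ) [W.IsElliptic] [W.IsGloballyMinimal] [NeZero (W.conductorNorm ℤ)],
    ¬ W.HasCM → (∀ n : ℕ, W.HasSurjectiveModNGaloisRep ((2 ^ n : ℕ) : ℤ)) → Odd W.torsionOrder → Odd W.tamagawaProduct →
    W.analyticRank = 1 → W.Δ < 0 → ShaTwoTrivial W →
    ∀ (K : Type) [Field K] [NumberField K], IsImaginaryQuadratic K →
      ∀ (q₀ : ℕ) [Fact q₀.Prime], TranspAdmissible W (NumberField.discr K) q₀ → MeetsNonNormAt W q₀ →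
        Nat.Coprime (NumberField.discr K).natAbs (W.conductorNorm ℤ) → SatisfiesHeegnerHypothesis (W.conductorNorm ℤ) K →
        twistSelmerTwoCard W (NumberField.discr K) = 1 →
        ∀ (Dt : ModularParametrizationData W (W.conductorNorm ℤ))
          (H : HeegnerDatum (W.conductorNorm ℤ) (NumberField.discr K)) (ι : K →+* ℂ)
          (P : (W.baseChange K).toAffine.Point),
          WeierstrassCurve.Affine.Point.map ι.toRatAlgHom P = heegnerPointComplex Dt H → Odd Dt.c →
          HasTwoDivisibilityUpToTorsion W K P 0

/-- **A point that is not `2`-divisible modulo torsion has infinite order** (import-free: if `P` were torsion, so would be the `Q` with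
`P − Q` torsion, and `Q = Q − 2·0` would be twice a point modulo torsion). [folklore] -/
theorem not_isOfFinAddOrder_of_hasTwoDivisibilityUpToTorsion_zero (W : WeierstrassCurve ℚ) (K : Type) [Field K] [NumberField K]
    (P : (W.baseChange K).toAffine.Point) (h : HasTwoDivisibilityUpToTorsion W K P 0) : ¬ IsOfFinAddOrder P := by
  intro hP
  obtain ⟨Q, hPQ, hQ⟩ := h
  rw [pow_zero, one_smul] at hPQ
  apply hQ
  refine ⟨0, ?_⟩
  rw [smul_zero, sub_zero]
  have hPt : P ∈ AddCommGroup.torsion (W.baseChange K).toAffine.Point := (AddCommGroup.mem_torsion _).mpr hP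
  have hQ' : Q = P - (P - Q) := by abel
  rw [hQ']
  exact (AddCommGroup.torsion (W.baseChange K).toAffine.Point).sub_mem hPt hPQ

/-! ### APPEND #10 (lead prover seat `bsd-line-fkl-p1` g15, 2026-08-28T21:2xZ) — LINE v8.15: the residue SPLIT into R⁻₀ and R₊

With R⁻₀ (APPEND #9) the curves of the class {`Δ_W < 0`, `Ш(W)[2] = 0`, an odd-constant datum exists} are never off the sub-slice
(`hasBottomRungDoorAtTwo_of_heegnerNonDivisibility`, `Theorems/…OneDoorSubsliceNegDisc.lean`), so v8.14's residue restricted to them is VACUOUS given R⁻₀,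
and what is left is the residue on the complement of the class — R₊ below.  Skeleton v8.15 carries the residue as the TWO registered stubs R⁻₀ and R₊
(`rankOneAtTwoBigImageOddLocal_of_heegnerNonDivisibility_of_residuePlus`); R₊ is v8.14's residue with one extra hypothesis (so residue ⟹ R₊ trivially),
and R⁻₀ ∧ R₊ ⟹ residue modulo the four primary printed facts; the only non-kernel step in «residue ⟹ R⁻₀» is the rank-`0` `2`-converse for the
`Sel₂`-trivial twin (the tree's rank-`0` `BSD₂` consumes `analyticRank = 0`).  Nothing is asserted; BSD is not proved by any of this. -/

/-- **R₊ `DoorIndexLawFullCAtTwoSomeDoorResiduePlus` — THE RESIDUE OFF THE R⁻₀ CLASS (CONJECTURE; registered stub of LINE v8.15 next to R⁻₀).**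
v8.14's residue `DoorIndexLawFullCAtTwoSomeDoorOffSubslice` with ONE extra hypothesis: `W` is NOT in the class {`Δ_W < 0`, `Ш(W)[2] = 0`, some
parametrisation datum of level `N_W` has odd constant}.  So R₊ is `BSD₂` in Heegner-index currency (∃ a lawful door datum) for the curves of the slice
without a bottom-rung door datum that have `Ш(W)[2] ≠ 0` (EVERY door has `m ≥ 1`: Kolyvagin exactness at `2` beyond the first layer, route
GenusKolyvaginAtTwo's 24882), or `Δ_W > 0` (the archimedean error place: -es U₀⁺ is in the tree for `m = 0`; `m ≥ 1` is the Δ>0 residual 24883), or no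
odd-constant datum (the `2`-primary Manin question at additive level `4 ∣ N`; at `4 ∤ N` Abbes–Ullmo / Česnavičius give one).  Why it might fail: as the
residue.  Census: AN-28c's rows with `s_W > 0` or `Δ > 0` (ENGINE L j300076 + j303912). [cite: GrossLMS1991, Conj. 1.2, §3 and §10] [cite: Kolyvagin1990, Thm. A] -/
@[conjecture] def DoorIndexLawFullCAtTwoSomeDoorResiduePlus : Prop :=
  ∀ (W : WeierstrassCurve ℚ) [W.IsElliptic] [W.IsGloballyMinimal] [NeZero (W.conductorNorm ℤ)],
    ¬ W.HasCM → (∀ n : ℕ, W.HasSurjectiveModNGaloisRep ((2 ^ n : ℕ) : ℤ)) → Odd W.torsionOrder → Odd W.tamagawaProduct →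
    W.analyticRank = 1 → ¬ HasBottomRungDoorAtTwo W →
    ¬ (W.Δ < 0 ∧ ShaTwoTrivial W ∧ ∃ Dt : ModularParametrizationData W (W.conductorNorm ℤ), Odd Dt.c) →
    HasLawfulDoorAtTwo W

/-- **Residue ⟹ R₊** (drop the extra hypothesis). [cite: GrossLMS1991, Conj. 1.2 and §3] -/
theorem doorIndexLawFullCAtTwoSomeDoorResiduePlus_of_offSubslice (h : DoorIndexLawFullCAtTwoSomeDoorOffSubslice) :
    DoorIndexLawFullCAtTwoSomeDoorResiduePlus :=
  fun W _ _ _ hCM hsurj hT hc hr hoff _ => h W hCM hsurj hT hc hr hoff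

/-- **R₊ + «the class lies in the sub-slice» ⟹ the residue** (import-free case split; the class hypothesis is discharged from R⁻₀ and the four
primary printed facts by `hasBottomRungDoorAtTwo_of_heegnerNonDivisibility` in `Theorems/…OneDoorSubsliceNegDisc.lean`).
[cite: GrossLMS1991, Conj. 1.2, §3 and §10] [cite: Zhang2014CJM, Thm. 1.1] -/
theorem doorIndexLawFullCAtTwoSomeDoorOffSubslice_of_residuePlus_of_class (hP : DoorIndexLawFullCAtTwoSomeDoorResiduePlus)
    (hcls : ∀ (W : WeierstrassCurve ℚ) [W.IsElliptic] [W.IsGloballyMinimal] [NeZero (W.conductorNorm ℤ)],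
      ¬ W.HasCM → (∀ n : ℕ, W.HasSurjectiveModNGaloisRep ((2 ^ n : ℕ) : ℤ)) → Odd W.torsionOrder → Odd W.tamagawaProduct →
      W.analyticRank = 1 → W.Δ < 0 → ShaTwoTrivial W →
      ∀ Dt : ModularParametrizationData W (W.conductorNorm ℤ), Odd Dt.c → HasBottomRungDoorAtTwo W) :
    DoorIndexLawFullCAtTwoSomeDoorOffSubslice := by
  intro W _ _ _ hCM hsurj hT hc hr hoff
  by_cases hin : W.Δ < 0 ∧ ShaTwoTrivial W ∧ ∃ Dt : ModularParametrizationData W (W.conductorNorm ℤ), Odd Dt.c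
  · obtain ⟨hΔ, hSha, Dt, hodd⟩ := hin
    exact absurd (hcls W hCM hsurj hT hc hr hΔ hSha Dt hodd) hoff
  · exact hP W hCM hsurj hT hc hr hoff hin

/-! ### APPEND #11 (lead prover seat `bsd-line-fkl-p1` g15, 2026-08-28T22:3xZ) — LINE v8.16: R₊ SPLIT by the EGG class (the width seat fkl-p2 g13's Δ>0 twin)

`Theorems/…OneDoorSubslicePosDisc.lean` (fkl-p2 g13, p671137) puts the class {`Δ_W > 0`, `Ш(W)[2] = 0`, `MeetsEgg W`, an odd-constant datum} on the proved
sub-slice modulo -an's EXISTING conjecture AN-13 `F1Sign2.HeegnerPointOnEggAtTwo` (door SUPPLIED by `GenusKolyTwin.exists_silent_prime_heegnerField`, exponent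
`0` by the egg lemma, non-vanishing by Gross–Zagier): `hasBottomRungDoorAtTwo_of_heegnerPointOnEggAtTwo`, and provides the composition
`doorIndexLawFullCAtTwoSomeDoorResiduePlus_of_heegnerPointOnEggAtTwo_of_rest` whose `hrest` is VERBATIM the body below.  So v8.16 registers R⁺₀ := AN-13
itself (by name) and R₊₊ below in place of R₊.  Nothing is asserted; BSD is not proved by any of this. -/

/-- **R₊₊ `DoorIndexLawFullCAtTwoSomeDoorResiduePlusPlus` — THE RESIDUE OFF BOTH FIRST-LAYER CLASSES (CONJECTURE; registered stub of LINE v8.16).**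
R₊ with ONE more hypothesis: `W` is NOT in the egg class {`0 < Δ_W`, `Ш(W)[2] = 0`, `MeetsEgg W`, some datum of level `N_W` has odd constant}.  So R₊₊ is `BSD₂`
in Heegner-index currency (∃ a lawful door datum) for the curves of the slice without a bottom-rung door datum that have `Ш(W)[2] ≠ 0` (every door `m ≥ 1`:
Kolyvagin exactness at `2` beyond the first layer — route GenusKolyvaginAtTwo's 24882), or `Δ_W > 0` with `E(ℚ) ⊂ E⁰(ℝ)` (the non-egg locus: -an's η_f = 0,
the Δ>0 residual 24883), or no odd-constant datum (the `2`-primary Manin question at `4 ∣ N`).  On the first two populations the hypothesis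
`¬ HasBottomRungDoorAtTwo W` is itself a THEOREM modulo print (fkl-p2's `not_hasBottomRungDoorAtTwo_of_not_shaTwoTrivial` / `…_of_not_meetsEgg`).
Why it might fail: as the residue.  Census: AN-28c's rows with `s_W > 0` or (Δ > 0, egg bit 0) (ENGINE L j300076 + j303912; -an ENGINE E/HC).
[cite: GrossLMS1991, Conj. 1.2, §3 and §10] [cite: Kolyvagin1990, Thm. A] -/
@[conjecture] def DoorIndexLawFullCAtTwoSomeDoorResiduePlusPlus : Prop :=
  ∀ (W : WeierstrassCurve ℚ) [W.IsElliptic] [W.IsGloballyMinimal] [NeZero (W.conductorNorm ℤ)],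
    ¬ W.HasCM → (∀ n : ℕ, W.HasSurjectiveModNGaloisRep ((2 ^ n : ℕ) : ℤ)) → Odd W.torsionOrder → Odd W.tamagawaProduct →
    W.analyticRank = 1 → ¬ HasBottomRungDoorAtTwo W →
    ¬ (W.Δ < 0 ∧ ShaTwoTrivial W ∧ ∃ Dt : ModularParametrizationData W (W.conductorNorm ℤ), Odd Dt.c) →
    ¬ (0 < W.Δ ∧ ShaTwoTrivial W ∧ MeetsEgg W ∧ ∃ Dt : ModularParametrizationData W (W.conductorNorm ℤ), Odd Dt.c) →
    HasLawfulDoorAtTwo W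

/-- **R₊ ⟹ R₊₊** (drop the extra hypothesis). [cite: GrossLMS1991, Conj. 1.2 and §3] -/
theorem doorIndexLawFullCAtTwoSomeDoorResiduePlusPlus_of_residuePlus (h : DoorIndexLawFullCAtTwoSomeDoorResiduePlus) :
    DoorIndexLawFullCAtTwoSomeDoorResiduePlusPlus :=
  fun W _ _ _ hCM hsurj hT hc hr hoff hneg _ => h W hCM hsurj hT hc hr hoff hneg

/-- **R₊₊ + «the egg class lies in the sub-slice» ⟹ R₊** (import-free case split; the class hypothesis is discharged from AN-13 and four printed facts by
fkl-p2's `hasBottomRungDoorAtTwo_of_heegnerPointOnEggAtTwo`, and the same composition with the body inlined is its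
`doorIndexLawFullCAtTwoSomeDoorResiduePlus_of_eggClass_of_rest`). [cite: GrossLMS1991, Conj. 1.2, §3 and §10] [cite: Zhang2014CJM, Thm. 1.1] -/
theorem doorIndexLawFullCAtTwoSomeDoorResiduePlus_of_residuePlusPlus_of_eggClass (hPP : DoorIndexLawFullCAtTwoSomeDoorResiduePlusPlus)
    (hcls : ∀ (W : WeierstrassCurve ℚ) [W.IsElliptic] [W.IsGloballyMinimal] [NeZero (W.conductorNorm ℤ)],
      ¬ W.HasCM → (∀ n : ℕ, W.HasSurjectiveModNGaloisRep ((2 ^ n : ℕ) : ℤ)) → Odd W.torsionOrder → Odd W.tamagawaProduct →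
      W.analyticRank = 1 → 0 < W.Δ → ShaTwoTrivial W → MeetsEgg W →
      ∀ Dt : ModularParametrizationData W (W.conductorNorm ℤ), Odd Dt.c → HasBottomRungDoorAtTwo W) :
    DoorIndexLawFullCAtTwoSomeDoorResiduePlus := by
  intro W _ _ _ hCM hsurj hT hc hr hoff hneg
  by_cases hin : 0 < W.Δ ∧ ShaTwoTrivial W ∧ MeetsEgg W ∧ ∃ Dt : ModularParametrizationData W (W.conductorNorm ℤ), Odd Dt.c
  · obtain ⟨hΔ, hSha, hmeets, Dt, hodd⟩ := hin
    exact absurd (hcls W hCM hsurj hT hc hr hΔ hSha hmeets Dt hodd) hoff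
  · exact hPP W hCM hsurj hT hc hr hoff hneg hin

end Summit.BirchSwinnertonDyer.BirchSwinnertonDyer.Theorems.RankOneAtTwoOneDoor

end
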